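import Summits.CriticalPhenomena.PercolationContinuityZ3.Theorems.SahiMasterFamilyStrictHierarchyParams

/-!
# Strictness of Sahi's hierarchy at every order, VI: `μ_w` is positive on families of proper up-sets of order `< w`

Support file of the master-family programme (crux `NoHeavyLowerTail`, stmt-CriticalPhenomena-4575; cell `prim-masterthm`,
seat P4, unit `prim-masterthm-p4-g4`).  The two lower estimates of `SahiMasterFamilyStrictHierarchy` (seat file PROOF-STRICTNESS.md
§4 (b), (c)), from the light-atom expansion `E_{n+1} ≥ S₁ − S₂ − T` (`SahiLightAtoms.sahiE_setInd_ge`):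

* `sahiE_nonneg_of_common_mid` — (c) order `n+1 ≤ w−1`, proper up-sets with an atom common to all members: the first-order
  term `S₁ ≥ ε n!(1 − nε)` dominates `S₂ ≤ ε² 2^{n+1} n! (w+2)²` and the tail;
* `sahiE_nonneg_of_no_common_mid` — (b) order `n+1 ≤ w−1`, proper nonempty up-sets with NO common atom: `S₁ = ffm t n ≥ t n!(1−nt)`
  and, by the PIGEONHOLE heart `SahiPairFunctional.sum_offDiag_rpairSum_le`, `S₂ ≤ ε²(Q−1) n! + O(ε³)`, so with `t = ε²(Q − ½)` the
  margin `ε² n!/2` survives: `E ≥ n! ε² (½ − 3/16) > 0`.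
HONEST FRAMING: a theorem about one explicit non-FKG law; nothing here bears on `C_n` for FKG or product measures. [this work]
-/

namespace Summit.CriticalPhenomena.PercolationContinuityZ3.Theorems

namespace SahiStrictHierarchy

open Finset Function
open Literature.Combinatorics.Sahi2008 SahiRepresentativeForm SahiPairFunctional SahiLightAtoms PW

variable {w : ℕ}

/-! ### (c) a common atom: the first-order term dominates -/

/-- **Case (c).** Order `n+1 ≤ w−1`, proper nonempty up-sets with an atom `m_{j₀}` common to all: `E_{n+1} ≥ 0`. [this work] -/
theorem sahiE_nonneg_of_common_mid (hw : 2 ≤ w) {n : ℕ} (hn : n + 2 ≤ w) (U : Fin (n + 1) → Finset (PW w))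
    (hU : ∀ i, IsUpperSet ((U i : Finset (PW w)) : Set (PW w))) (hprop : ∀ i, U i ≠ univ)
    {j₀ : Fin w} (hj₀ : ∀ i, mid j₀ ∈ U i) : 0 ≤ sahiE (lawW w) (n + 1) (fun i => setInd (U i)) := by
  have hε := (epsW_pos w)
  have hε1 := (epsW_le_one w)
  have ht := topW_bounds hw
  have hW := (two_le_W w)
  have hl : ∀ i, ∀ a ∈ U i, 0 ≤ lawW w a ∧ lawW w a ≤ epsW w := fun i => lawW_light hw (hU i) (hprop i)
  set ε := epsW w with hεdef
  set t := topW w with htdef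
  set W : ℝ := (w : ℝ) + 2 with hWdef
  set F : ℝ := (n.factorial : ℝ) with hFdef
  have hF : 0 < F := by rw [hFdef]; exact_mod_cast Nat.factorial_pos n
  -- the expansion
  have hge := sahiE_setInd_ge (lawW w) n U hε.le hε1 hl
  -- first order: the constant system at `m_{j₀}`
  have hS1 : ε * (F * (1 - n * ε)) ≤ sumOne (lawW w) U := by
    rw [sumOne_eq]
    calc ε * (F * (1 - n * ε)) ≤ ffm (lawW w (mid j₀)) n := by
          have := ffm_ge hε.le hε1 n; simpa [lawW, muW] using this
      _ ≤ ∑ a ∈ univ.filter (fun a => ∀ i, a ∈ U i), ffm (lawW w a) n := by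
          have hmem : mid j₀ ∈ univ.filter (fun a => ∀ i, a ∈ U i) := mem_filter.2 ⟨mem_univ _, hj₀⟩
          refine single_le_sum (f := fun a => ffm (lawW w a) n) (fun a ha => ?_) hmem
          rw [mem_filter] at ha
          have := hl 0 a (ha.2 0)
          exact ffm_nonneg this.1 (this.2.trans hε1) _
  -- second order: crude bound `ε² 2^{n+1} n! (w² + w)`
  have hcrude : ∀ R R' : Finset (Fin (n + 1)), (rpairSum R R' : ℝ) ≤ 2 ^ (n + 1) * F := fun R R' => by
    rw [hFdef]; exact_mod_cast rpairSum_le_pow_mul_factorial R R'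
  have hS2 : sumTwo (lawW w) U ≤ ε ^ 2 * (2 ^ (n + 1) * F) * W ^ 2 := by
    refine (sumTwo_le (lawW w) U hε1 hl).trans ?_
    rw [pairTotal_eq U hU hprop]
    have hmm : ∑ q ∈ (univ : Finset (Fin w)).offDiag, (rpairSum (rows U (mid q.1)) (rows U (mid q.2)) : ℝ) ≤
        ((w : ℝ) * w - w) * (2 ^ (n + 1) * F) := by
      calc ∑ q ∈ (univ : Finset (Fin w)).offDiag, (rpairSum (rows U (mid q.1)) (rows U (mid q.2)) : ℝ)
          ≤ ∑ q ∈ (univ : Finset (Fin w)).offDiag, 2 ^ (n + 1) * F := sum_le_sum fun q _ => hcrude _ _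
        _ = ((w : ℝ) * w - w) * (2 ^ (n + 1) * F) := by
          rw [sum_const, nsmul_eq_mul, offDiag_card, Finset.card_univ, Fintype.card_fin]
          push_cast [Nat.cast_sub (Nat.le_mul_self w)]
          ring
    have htm : ∑ j : Fin w, ((rpairSum (rows U top) (rows U (mid j)) : ℝ) + rpairSum (rows U (mid j)) (rows U top)) ≤
        (w : ℝ) * (2 * (2 ^ (n + 1) * F)) := by
      calc ∑ j : Fin w, ((rpairSum (rows U top) (rows U (mid j)) : ℝ) + rpairSum (rows U (mid j)) (rows U top))
          ≤ ∑ j : Fin w, (2 ^ (n + 1) * F + 2 ^ (n + 1) * F) :=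
            sum_le_sum fun j _ => add_le_add (hcrude _ _) (hcrude _ _)
        _ = (w : ℝ) * (2 * (2 ^ (n + 1) * F)) := by
            rw [sum_const, Finset.card_univ, Fintype.card_fin, nsmul_eq_mul]; ring
    have h2F : (0 : ℝ) ≤ 2 ^ (n + 1) * F := by positivity
    have hw0 : (0 : ℝ) ≤ w := Nat.cast_nonneg _
    calc ε ^ 2 * ∑ q ∈ (univ : Finset (Fin w)).offDiag, (rpairSum (rows U (mid q.1)) (rows U (mid q.2)) : ℝ) +
          t * ε * ∑ j : Fin w, ((rpairSum (rows U top) (rows U (mid j)) : ℝ) + rpairSum (rows U (mid j)) (rows U top))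
        ≤ ε ^ 2 * (((w : ℝ) * w - w) * (2 ^ (n + 1) * F)) + ε * ε * ((w : ℝ) * (2 * (2 ^ (n + 1) * F))) := by
          have h1 := mul_le_mul_of_nonneg_left hmm (pow_nonneg hε.le 2)
          have h2 : t * ε * _ ≤ ε * ε * ((w : ℝ) * (2 * (2 ^ (n + 1) * F))) :=
            mul_le_mul (mul_le_mul_of_nonneg_right ht.2.2 hε.le) htm
              (sum_nonneg fun j _ => by positivity) (mul_nonneg hε.le hε.le)
          linarith
      _ = ε ^ 2 * (2 ^ (n + 1) * F) * ((w : ℝ) * w + w) := by ring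
      _ ≤ ε ^ 2 * (2 ^ (n + 1) * F) * W ^ 2 := by
          refine mul_le_mul_of_nonneg_left ?_ (by positivity)
          rw [hWdef]; nlinarith
  -- tail
  have hT : ((Fintype.piFinset U).card : ℝ) * (ε ^ 3 * (n + 1).factorial) ≤
      ε ^ 3 * (W ^ (n + 1) * ((n : ℝ) + 1)) * F := tail_le U
  -- the numerical heart: `ε (n + 2^{n+1} W² + W^{n+1}(n+1)) ≤ 3/32`
  have hX : ε * ((n : ℝ) + 2 ^ (n + 1) * W ^ 2 + W ^ (n + 1) * ((n : ℝ) + 1)) ≤ 3 / 16 := by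
    refine eps_mul_le ?_
    have hnw : (n : ℝ) ≤ w := by exact_mod_cast (show n ≤ w by omega)
    have hn' : (n : ℝ) ≤ W := by rw [hWdef]; linarith
    have hn1 : (n : ℝ) + 1 ≤ W := by rw [hWdef]; linarith
    have h1 : (n : ℝ) ≤ W ^ (w + 3) := hn'.trans (by
      have := (W_pow_le_pow (w := w) (show 1 ≤ w + 3 by omega)); rwa [pow_one] at this)
    have h2 : (2 : ℝ) ^ (n + 1) * W ^ 2 ≤ W ^ (w + 3) := by
      calc (2 : ℝ) ^ (n + 1) * W ^ 2 ≤ W ^ (n + 1) * W ^ 2 :=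
            mul_le_mul_of_nonneg_right (two_pow_le_W_pow (w := w) ((n + 1))) (by positivity)
        _ = W ^ (n + 3) := by rw [← pow_add]
        _ ≤ W ^ (w + 3) := (W_pow_le_pow (by omega))
    have h3 : W ^ (n + 1) * ((n : ℝ) + 1) ≤ W ^ (w + 3) := by
      calc W ^ (n + 1) * ((n : ℝ) + 1) ≤ W ^ (n + 1) * W :=
            mul_le_mul_of_nonneg_left hn1 (by positivity)
        _ = W ^ (n + 2) := by ring
        _ ≤ W ^ (w + 3) := (W_pow_le_pow (by omega))
    linarith
  -- assemble
  have hε2 : ε ^ 3 * (W ^ (n + 1) * ((n : ℝ) + 1)) * F ≤ ε ^ 2 * (W ^ (n + 1) * ((n : ℝ) + 1)) * F := by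
    have : ε ^ 3 ≤ ε ^ 2 := by nlinarith
    have h0 : (0 : ℝ) ≤ (W ^ (n + 1) * ((n : ℝ) + 1)) * F := by positivity
    nlinarith
  have hpos : 0 ≤ ε * F * (1 - ε * ((n : ℝ) + 2 ^ (n + 1) * W ^ 2 + W ^ (n + 1) * ((n : ℝ) + 1))) :=
    mul_nonneg (mul_nonneg hε.le hF.le) (by linarith)
  calc (0 : ℝ) ≤ ε * F * (1 - ε * ((n : ℝ) + 2 ^ (n + 1) * W ^ 2 + W ^ (n + 1) * ((n : ℝ) + 1))) := hpos
    _ = ε * (F * (1 - n * ε)) - ε ^ 2 * (2 ^ (n + 1) * F) * W ^ 2 - ε ^ 2 * (W ^ (n + 1) * ((n : ℝ) + 1)) * F := by ring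
    _ ≤ ε * (F * (1 - n * ε)) - ε ^ 2 * (2 ^ (n + 1) * F) * W ^ 2 - ε ^ 3 * (W ^ (n + 1) * ((n : ℝ) + 1)) * F := by
        linarith
    _ ≤ sumOne (lawW w) U - sumTwo (lawW w) U - (Fintype.piFinset U).card * (ε ^ 3 * (n + 1).factorial) := by
        linarith
    _ ≤ sahiE (lawW w) (n + 1) (fun i => setInd (U i)) := hge

/-! ### (b) no common atom: the second-order gap -/

/-- **Case (b).** Order `n+1 ≤ w−1`, proper nonempty up-sets with NO atom common to all: `E_{n+1} ≥ 0` — the pigeonhole heart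
`2·Σ rpairSum ≤ (w² − w − 2)·n!` leaves the margin `ε² n!/2`. [this work] -/
theorem sahiE_nonneg_of_no_common_mid (hw : 2 ≤ w) {n : ℕ} (hn : n + 2 ≤ w) (U : Fin (n + 1) → Finset (PW w))
    (hU : ∀ i, IsUpperSet ((U i : Finset (PW w)) : Set (PW w))) (hprop : ∀ i, U i ≠ univ) (hne : ∀ i, (U i).Nonempty)
    (hnf : ∀ j, ∃ i, mid j ∉ U i) : 0 ≤ sahiE (lawW w) (n + 1) (fun i => setInd (U i)) := by
  have hε := (epsW_pos w)
  have hε1 := (epsW_le_one w)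
  have ht := topW_bounds hw
  have hW := (two_le_W w)
  have hQ := QW_le w
  have hQ1 := one_le_QW hw
  have hl : ∀ i, ∀ a ∈ U i, 0 ≤ lawW w a ∧ lawW w a ≤ epsW w := fun i => lawW_light hw (hU i) (hprop i)
  set ε := epsW w with hεdef
  set t := topW w with htdef
  set Q := QW w with hQdef
  set W : ℝ := (w : ℝ) + 2 with hWdef
  set F : ℝ := (n.factorial : ℝ) with hFdef
  have hF : 0 < F := by rw [hFdef]; exact_mod_cast Nat.factorial_pos n
  have htQ : t = ε ^ 2 * (Q - 1 / 2) := rfl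
  have hge := sahiE_setInd_ge (lawW w) n U hε.le hε1 hl
  -- first order: exactly the constant system at `⊤`
  have hS1 : t * (F * (1 - n * t)) ≤ sumOne (lawW w) U := by
    rw [sumOne_eq]
    have hcommon : univ.filter (fun a => ∀ i, a ∈ U i) = {top} := by
      ext a
      rw [mem_common_iff U hU hprop hne, mem_singleton]
      constructor
      · rintro (h | ⟨j, rfl, hj⟩)
        · exact h
        · obtain ⟨i, hi⟩ := hnf j; exact absurd (hj i) hi
      · exact Or.inl
    rw [hcommon, sum_singleton]
    have := ffm_ge ht.1.le (ht.2.2.trans hε1) n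
    simpa [lawW, muW] using this
  -- second order: the heart
  have hcols : ∀ j, rows U (mid j) ≠ univ := fun j h => by
    obtain ⟨i, hi⟩ := hnf j
    have : i ∈ rows U (mid j) := h ▸ mem_univ i
    exact hi (mem_rows.1 this)
  have hheart : 2 * ∑ q ∈ (univ : Finset (Fin w)).offDiag, (rpairSum (rows U (mid q.1)) (rows U (mid q.2)) : ℝ) ≤
      ((w : ℝ) * w - w - 2) * F := by
    have h := sum_offDiag_rpairSum_le (by omega : n + 1 < w) (fun j => rows U (mid j)) hcols
    have hw2 : 2 ≤ w * w - w := Nat.le_sub_of_add_le (by nlinarith)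
    have h' := (Nat.cast_le (α := ℝ)).2 h
    push_cast [Nat.cast_sub hw2, Nat.cast_sub (Nat.le_mul_self w)] at h'
    rw [hFdef]
    exact h'
  have hcrude : ∀ R R' : Finset (Fin (n + 1)), (rpairSum R R' : ℝ) ≤ 2 ^ (n + 1) * F := fun R R' => by
    rw [hFdef]; exact_mod_cast rpairSum_le_pow_mul_factorial R R'
  have hS2 : sumTwo (lawW w) U ≤ ε ^ 2 * ((Q - 1) * F) + ε ^ 3 * (2 * (w : ℝ) * Q * 2 ^ (n + 1)) * F := by
    refine (sumTwo_le (lawW w) U hε1 hl).trans ?_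
    rw [pairTotal_eq U hU hprop]
    have hmm : ∑ q ∈ (univ : Finset (Fin w)).offDiag, (rpairSum (rows U (mid q.1)) (rows U (mid q.2)) : ℝ) ≤
        (Q - 1) * F := by
      have : ((w : ℝ) * w - w - 2) = 2 * (Q - 1) := by rw [hQdef]; unfold QW; ring
      rw [this] at hheart
      linarith
    have htm : ∑ j : Fin w, ((rpairSum (rows U top) (rows U (mid j)) : ℝ) + rpairSum (rows U (mid j)) (rows U top)) ≤
        (w : ℝ) * (2 * (2 ^ (n + 1) * F)) := by
      calc ∑ j : Fin w, ((rpairSum (rows U top) (rows U (mid j)) : ℝ) + rpairSum (rows U (mid j)) (rows U top))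
          ≤ ∑ j : Fin w, (2 ^ (n + 1) * F + 2 ^ (n + 1) * F) :=
            sum_le_sum fun j _ => add_le_add (hcrude _ _) (hcrude _ _)
        _ = (w : ℝ) * (2 * (2 ^ (n + 1) * F)) := by
            rw [sum_const, Finset.card_univ, Fintype.card_fin, nsmul_eq_mul]; ring
    have hw0 : (0 : ℝ) ≤ w := Nat.cast_nonneg _
    have h1 := mul_le_mul_of_nonneg_left hmm (pow_nonneg hε.le 2)
    have h2 : t * ε * ∑ j : Fin w, ((rpairSum (rows U top) (rows U (mid j)) : ℝ) + rpairSum (rows U (mid j)) (rows U top))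
        ≤ (ε ^ 2 * Q) * ε * ((w : ℝ) * (2 * (2 ^ (n + 1) * F))) :=
      mul_le_mul (mul_le_mul_of_nonneg_right ht.2.1 hε.le) htm (sum_nonneg fun j _ => by positivity)
        (by positivity)
    calc _ ≤ ε ^ 2 * ((Q - 1) * F) + (ε ^ 2 * Q) * ε * ((w : ℝ) * (2 * (2 ^ (n + 1) * F))) := by linarith
      _ = ε ^ 2 * ((Q - 1) * F) + ε ^ 3 * (2 * (w : ℝ) * Q * 2 ^ (n + 1)) * F := by ring
  have hT : ((Fintype.piFinset U).card : ℝ) * (ε ^ 3 * (n + 1).factorial) ≤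
      ε ^ 3 * (W ^ (n + 1) * ((n : ℝ) + 1)) * F := tail_le U
  -- numerical heart: `Y = n Q² + 2 w Q 2^{n+1} + (n+1) W^{n+1} ≤ 3 W^{w+3}`
  have hY : ε * ((n : ℝ) * Q ^ 2 + 2 * (w : ℝ) * Q * 2 ^ (n + 1) + W ^ (n + 1) * ((n : ℝ) + 1)) ≤ 3 / 16 := by
    refine eps_mul_le ?_
    have hn2 : (n : ℝ) + 2 ≤ w := by exact_mod_cast hn
    have hn' : (n : ℝ) + 1 ≤ W := by rw [hWdef]; linarith
    have hwW : (w : ℝ) ≤ W := by rw [hWdef]; linarith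
    have hn0 : (0 : ℝ) ≤ n := Nat.cast_nonneg _
    have hw0 : (0 : ℝ) ≤ w := Nat.cast_nonneg _
    have h1 : (n : ℝ) * Q ^ 2 ≤ W ^ (w + 3) := by
      calc (n : ℝ) * Q ^ 2 ≤ W * (W ^ 2) ^ 2 := by
            refine mul_le_mul (by linarith) (pow_le_pow_left₀ hQ.1 hQ.2 2) (by positivity) (by positivity)
        _ = W ^ 5 := by ring
        _ ≤ W ^ (w + 3) := (W_pow_le_pow (by omega))
    have h2 : 2 * (w : ℝ) * Q * 2 ^ (n + 1) ≤ W ^ (w + 3) := by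
      calc 2 * (w : ℝ) * Q * 2 ^ (n + 1) ≤ 2 * W * W ^ 2 * W ^ (n + 1) := by
            have h22 := (two_pow_le_W_pow (w := w) ((n + 1)))
            have : 2 * (w : ℝ) * Q ≤ 2 * W * W ^ 2 := by nlinarith
            exact mul_le_mul this h22 (by positivity) (by positivity)
        _ = 2 * W ^ (n + 4) := by ring
        _ ≤ W * W ^ (n + 4) := mul_le_mul_of_nonneg_right hW (by positivity)
        _ = W ^ (n + 5) := by ring
        _ ≤ W ^ (w + 3) := (W_pow_le_pow (by omega))
    have h3 : W ^ (n + 1) * ((n : ℝ) + 1) ≤ W ^ (w + 3) := by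
      calc W ^ (n + 1) * ((n : ℝ) + 1) ≤ W ^ (n + 1) * W := mul_le_mul_of_nonneg_left hn' (by positivity)
        _ = W ^ (n + 2) := by ring
        _ ≤ W ^ (w + 3) := (W_pow_le_pow (by omega))
    linarith
  -- assemble: `E ≥ F ε² (1/2 − ε Y) ≥ 0`
  have hnt : (n : ℝ) * t ^ 2 ≤ ε ^ 3 * ((n : ℝ) * Q ^ 2) := by
    -- `n t² ≤ n ε⁴ Q² ≤ ε³ n Q²`
    have h0 : (0 : ℝ) ≤ n := Nat.cast_nonneg _
    have h1 : t ^ 2 ≤ (ε ^ 2 * Q) ^ 2 := pow_le_pow_left₀ ht.1.le ht.2.1 2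
    have h2 : (ε ^ 2 * Q) ^ 2 ≤ ε ^ 3 * Q ^ 2 := by
      have h4 : ε ^ 4 ≤ ε ^ 3 := pow_le_pow_of_le_one hε.le hε1 (by norm_num)
      have : (ε ^ 2 * Q) ^ 2 = ε ^ 4 * Q ^ 2 := by ring
      rw [this]
      exact mul_le_mul_of_nonneg_right h4 (sq_nonneg Q)
    calc (n : ℝ) * t ^ 2 ≤ n * (ε ^ 3 * Q ^ 2) := mul_le_mul_of_nonneg_left (h1.trans h2) h0
      _ = ε ^ 3 * ((n : ℝ) * Q ^ 2) := by ring
  have key : F * (ε ^ 2 * (1 / 2 - ε * ((n : ℝ) * Q ^ 2 + 2 * (w : ℝ) * Q * 2 ^ (n + 1) + W ^ (n + 1) * ((n : ℝ) + 1))))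
      ≤ sumOne (lawW w) U - sumTwo (lawW w) U - (Fintype.piFinset U).card * (ε ^ 3 * (n + 1).factorial) := by
    have e1 : t * (F * (1 - n * t)) - (ε ^ 2 * ((Q - 1) * F) + ε ^ 3 * (2 * (w : ℝ) * Q * 2 ^ (n + 1)) * F)
        - ε ^ 3 * (W ^ (n + 1) * ((n : ℝ) + 1)) * F
        = F * (ε ^ 2 / 2 - n * t ^ 2 - ε ^ 3 * (2 * (w : ℝ) * Q * 2 ^ (n + 1)) - ε ^ 3 * (W ^ (n + 1) * ((n : ℝ) + 1))) := by
      rw [htQ]; ring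
    have e2 : F * (ε ^ 2 * (1 / 2 - ε * ((n : ℝ) * Q ^ 2 + 2 * (w : ℝ) * Q * 2 ^ (n + 1) + W ^ (n + 1) * ((n : ℝ) + 1))))
        ≤ F * (ε ^ 2 / 2 - n * t ^ 2 - ε ^ 3 * (2 * (w : ℝ) * Q * 2 ^ (n + 1)) - ε ^ 3 * (W ^ (n + 1) * ((n : ℝ) + 1))) := by
      refine mul_le_mul_of_nonneg_left ?_ hF.le
      have e3 : ε ^ 2 * (1 / 2 - ε * ((n : ℝ) * Q ^ 2 + 2 * (w : ℝ) * Q * 2 ^ (n + 1) + W ^ (n + 1) * ((n : ℝ) + 1))) =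
          ε ^ 2 / 2 - ε ^ 3 * ((n : ℝ) * Q ^ 2) - ε ^ 3 * (2 * (w : ℝ) * Q * 2 ^ (n + 1)) -
            ε ^ 3 * (W ^ (n + 1) * ((n : ℝ) + 1)) := by ring
      rw [e3]
      linarith only [hnt]
    linarith only [hge, hS1, hS2, hT, e1, e2]
  have hpos : 0 ≤ F * (ε ^ 2 * (1 / 2 - ε * ((n : ℝ) * Q ^ 2 + 2 * (w : ℝ) * Q * 2 ^ (n + 1) + W ^ (n + 1) * ((n : ℝ) + 1)))) :=
    mul_nonneg hF.le (mul_nonneg (pow_nonneg hε.le 2) (by linarith))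
  linarith

end SahiStrictHierarchy

end Summit.CriticalPhenomena.PercolationContinuityZ3.Theorems
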